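import Summits.CriticalPhenomena.CardyFormulaZ2.Theorems.CardyIKTransportIKMixedBoxCrossingTransportLinkDefs

/-!
# Stub `stub_linkTraceIneq` (H4), auxiliary file 1/2: `√3` arithmetic and the powers of `Smat`
# (line `defect-closure-exploration`, reshape v5b, crux `IKMixedBoxCrossing`, stmt-CriticalPhenomena-5911)

Support file (`--supports stmt-CriticalPhenomena-5911`), lead c5 memo `Cruxes/IKMixedBoxCrossing/Lines/defect-closure-exploration-c5.md`
§9.3: the sequence `ab n = (A_n, B_n)` (`A_0 = 1, B_0 = 0, A_{n+1} = A_n + t B_n, B_{n+1} = t A_n + B_n`, `t = √3/2`) with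
`Smat ^ n = [[A_n, B_n], [B_n, A_n]]` (`Smat_pow_apply`, registered helper), elementary bounds (`0 ≤ B_n ≤ A_n`, `t A_n ≤ B_n`,
`4 A_n ≤ 3·2^n`, `2 A_n ≤ 2^n`, `4 B_n ≤ √3·2^n`), and the entries of `M1`, `Fmat g - M1`.
-/

noncomputable section

namespace Summit.CriticalPhenomena.CardyFormulaZ2.Cruxes.IKMixedBoxCrossing.DefectClosureExploration

open scoped BigOperators Classical
open Finset Matrix

namespace LinkTraceIneqAux


/-! ## §1 `√3`, `t = √3/2`, `r_* = 7√3/15` -/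

/-- `s3 = √3`. -/
abbrev s3 : ℝ := Real.sqrt 3

/-- `√3 ^ 2 = 3` and `0 ≤ √3` (bundled). -/
theorem s3_facts : s3 ^ 2 = 3 ∧ 0 ≤ s3 := ⟨by rw [sq]; exact Real.mul_self_sqrt (by norm_num), Real.sqrt_nonneg 3⟩

/-- `1.732 < √3`. -/
theorem s3_gt : (1.732 : ℝ) < s3 := by
  rw [show (1.732 : ℝ) = Real.sqrt (1.732 ^ 2) by rw [Real.sqrt_sq (by norm_num)]]
  exact Real.sqrt_lt_sqrt (by norm_num) (by norm_num)

/-- `√3 < 1.7321`. -/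
theorem s3_lt : s3 < (1.7321 : ℝ) := by
  rw [show (1.7321 : ℝ) = Real.sqrt (1.7321 ^ 2) by rw [Real.sqrt_sq (by norm_num)]]
  exact Real.sqrt_lt_sqrt (by norm_num) (by norm_num)

/-- `tI = √3 / 2`. -/
theorem tI_eq : tI = s3 / 2 := rfl

/-- The sharp cone ratio `r_* = 7√3/15`. -/
def rS : ℝ := 7 * s3 / 15

/-- `r_* = 7√3/15` (unfolding lemma). -/
theorem rS_eq : rS = 7 * s3 / 15 := rfl

/-! ## §2 The sequence `(A_n, B_n)` and the powers of `Smat` -/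

/-- `ab n = (A_n, B_n)`: `A_0 = 1, B_0 = 0`, `A_{n+1} = A_n + t B_n`, `B_{n+1} = t A_n + B_n`. -/
def ab : ℕ → ℝ × ℝ
  | 0 => (1, 0)
  | n + 1 => ((ab n).1 + tI * (ab n).2, tI * (ab n).1 + (ab n).2)

/-- `A_n`. -/
abbrev A (n : ℕ) : ℝ := (ab n).1
/-- `B_n`. -/
abbrev B (n : ℕ) : ℝ := (ab n).2

/-- Recursion for `A`. -/
theorem A_succ (n : ℕ) : A (n + 1) = A n + s3 / 2 * B n := rfl
/-- Recursion for `B`. -/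
theorem B_succ (n : ℕ) : B (n + 1) = s3 / 2 * A n + B n := rfl
/-- `A_0 = 1`, `B_0 = 0`. -/
theorem ab_zero : A 0 = 1 ∧ B 0 = 0 := ⟨rfl, rfl⟩
/-- `A_1 = 1`. -/
theorem A_one : A 1 = 1 := by rw [A_succ, ab_zero.1, ab_zero.2]; ring
/-- `B_1 = √3/2`. -/
theorem B_one : B 1 = s3 / 2 := by rw [B_succ, ab_zero.1, ab_zero.2]; ring
/-- `A_2 = 7/4`. -/
theorem A_two : A 2 = 7 / 4 := by rw [A_succ, A_one, B_one]; nlinarith [s3_facts.1]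
/-- `B_2 = √3`. -/
theorem B_two : B 2 = s3 := by rw [B_succ, A_one, B_one]; ring
/-- `A_3 = 13/4`. -/
theorem A_three : A 3 = 13 / 4 := by rw [A_succ, A_two, B_two]; nlinarith [s3_facts.1]
/-- `B_3 = 15√3/8`. -/
theorem B_three : B 3 = 15 * s3 / 8 := by rw [B_succ, A_two, B_two]; ring

/-- `0 < A_n`, `0 ≤ B_n ≤ A_n`. -/
theorem AB_bounds (n : ℕ) : 0 < A n ∧ 0 ≤ B n ∧ B n ≤ A n := by
  induction n with
  | zero => rw [ab_zero.1, ab_zero.2]; norm_num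
  | succ n ih =>
    rw [A_succ, B_succ]
    refine ⟨?_, ?_, ?_⟩ <;> nlinarith [ih.1, ih.2.1, ih.2.2, s3_gt, s3_lt]

/-- `(√3/2) A_n ≤ B_n` for `n ≥ 1`. -/
theorem tA_le_B (n : ℕ) (hn : 1 ≤ n) : s3 / 2 * A n ≤ B n := by
  induction n with
  | zero => omega
  | succ n ih =>
    rcases Nat.eq_zero_or_pos n with rfl | hpos
    · rw [A_one, B_one, mul_one]
    · have := ih hpos
      rw [A_succ, B_succ]
      nlinarith [s3_facts.1, (AB_bounds n).2.1]

/-- `4 A_n ≤ 3 · 2^n` for `n ≥ 2`. -/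
theorem four_A_le (n : ℕ) (hn : 2 ≤ n) : 4 * A n ≤ 3 * 2 ^ n := by
  induction n with
  | zero => omega
  | succ n ih =>
    rcases Nat.lt_or_ge n 2 with hlt | hge
    · have : n = 1 := by omega
      subst this
      rw [A_two]; norm_num
    · have := ih hge
      rw [A_succ, pow_succ]
      nlinarith [(AB_bounds n).2.2, (AB_bounds n).2.1, s3_lt]

/-- `2 A_n ≤ 2^n` for `n ≥ 1` (i.e. `(1+t)^n + (1-t)^n ≤ 2^n`). -/
theorem two_A_le (n : ℕ) (hn : 1 ≤ n) : 2 * A n ≤ 2 ^ n := by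
  induction n with
  | zero => omega
  | succ n ih =>
    rcases Nat.eq_zero_or_pos n with rfl | hpos
    · rw [A_one]; norm_num
    · have := ih hpos
      rw [A_succ, pow_succ]
      nlinarith [(AB_bounds n).2.2, (AB_bounds n).2.1, s3_lt]

/-- `4 B_n ≤ √3 · 2^n` for `n ≥ 2` (equality at `n = 2`). -/
theorem four_B_le (n : ℕ) (hn : 2 ≤ n) : 4 * B n ≤ s3 * 2 ^ n := by
  induction n with
  | zero => omega
  | succ n ih =>
    rcases Nat.lt_or_ge n 2 with hlt | hge
    · have : n = 1 := by omega
      subst this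
      rw [B_two]; nlinarith [(lt_trans (by norm_num) s3_gt : (0:ℝ) < s3), show (2 : ℝ) ^ (1 + 1) = 4 by norm_num]
    · have := ih hge
      have htB := tA_le_B n (by omega)
      rw [B_succ, pow_succ]
      nlinarith [(AB_bounds n).2.1, (lt_trans (by norm_num) s3_gt : (0:ℝ) < s3)]

/-- Entries of `Smat`. -/
theorem Smat_apply : Smat 0 0 = 1 ∧ Smat 0 1 = s3 / 2 ∧ Smat 1 0 = s3 / 2 ∧ Smat 1 1 = 1 := by
  refine ⟨by simp [Smat], ?_, ?_, by simp [Smat]⟩ <;> simp [Smat, tI_eq]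

/-- `Smat ^ n = [[A_n, B_n], [B_n, A_n]]`, entrywise. -/
theorem Smat_pow_apply : ∀ n : ℕ,
    (Smat ^ n) 0 0 = A n ∧ (Smat ^ n) 0 1 = B n ∧ (Smat ^ n) 1 0 = B n ∧ (Smat ^ n) 1 1 = A n := by
  intro n
  obtain ⟨s00, s01, s10, s11⟩ := Smat_apply
  induction n with
  | zero => simp [ab_zero.1, ab_zero.2]
  | succ n ih =>
    obtain ⟨h00, h01, h10, h11⟩ := ih
    rw [pow_succ]
    simp only [Matrix.mul_apply, Fin.sum_univ_two, h00, h01, h10, h11, s00, s01, s10, s11, A_succ, B_succ]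
    refine ⟨by ring, by ring, by ring, by ring⟩

/-- Entries of `Fmat g = Smat ^ (g+1)`. -/
theorem Fmat_apply (g : ℕ) :
    (Fmat g) 0 0 = A (g + 1) ∧ (Fmat g) 0 1 = B (g + 1) ∧ (Fmat g) 1 0 = B (g + 1) ∧ (Fmat g) 1 1 = A (g + 1) :=
  Smat_pow_apply (g + 1)

/-- `3/4 r_*² + (√3/2) r_* + 1/4 = 36/25` (the value `⟨ν*, u uᵀ⟩ = (r_* t + ½)²`). -/
theorem nuStar_val : 3 / 4 * (rS * rS) + s3 / 2 * rS + 1 / 4 = 36 / 25 := by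
  rw [rS_eq]; nlinarith [s3_facts.1]

/-- Entries of `M1 = u uᵀ`: `[[3/4, √3/4], [√3/4, 1/4]]`. -/
theorem M1_apply : M1 0 0 = 3 / 4 ∧ M1 0 1 = s3 / 4 ∧ M1 1 0 = s3 / 4 ∧ M1 1 1 = 1 / 4 := by
  have e : M1 0 0 = tI * tI ∧ M1 0 1 = tI * (1 / 2) ∧ M1 1 0 = 1 / 2 * tI ∧ M1 1 1 = 1 / 2 * (1 / 2) := by
    simp [M1, uvec, Matrix.vecMulVec_apply]
  obtain ⟨e00, e01, e10, e11⟩ := e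
  rw [e00, e01, e10, e11, tI_eq]
  refine ⟨by nlinarith [s3_facts.1], by ring, by ring, by ring⟩

/-- Entries of `Fmat g - M1`. -/
theorem M0_apply (g : ℕ) :
    (Fmat g - M1) 0 0 = A (g + 1) - 3 / 4 ∧ (Fmat g - M1) 0 1 = B (g + 1) - s3 / 4 ∧
      (Fmat g - M1) 1 0 = B (g + 1) - s3 / 4 ∧ (Fmat g - M1) 1 1 = A (g + 1) - 1 / 4 := by
  obtain ⟨h00, h01, h10, h11⟩ := Smat_pow_apply (g + 1)
  obtain ⟨m00, m01, m10, m11⟩ := M1_apply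
  simp only [Fmat, Matrix.sub_apply, h00, h01, h10, h11, m00, m01, m10, m11, and_self]

/-- The exceptional generator `Fmat 1 - M1 = [[1, 3√3/4], [3√3/4, 3/2]]`. -/
theorem M0one_apply :
    (Fmat 1 - M1) 0 0 = 1 ∧ (Fmat 1 - M1) 0 1 = 3 * s3 / 4 ∧ (Fmat 1 - M1) 1 0 = 3 * s3 / 4 ∧
      (Fmat 1 - M1) 1 1 = 3 / 2 := by
  obtain ⟨e00, e01, e10, e11⟩ := M0_apply 1
  rw [e00, e01, e10, e11, A_two, B_two]
  refine ⟨by norm_num, by ring, by ring, by norm_num⟩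

end LinkTraceIneqAux

end Summit.CriticalPhenomena.CardyFormulaZ2.Cruxes.IKMixedBoxCrossing.DefectClosureExploration

end
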